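import Mathlib
import HarnessLib
import Summits.HubbardSuperconductivity.HubbardSuperconductivity.Theorems.KLProgrammeKLRegimeEngineTwoLegSlopesBareFrame
import Summits.HubbardSuperconductivity.HubbardSuperconductivity.Theorems.KLProgrammeKLRegimeSplitSlotsV17FReadJets
import Summits.HubbardSuperconductivity.HubbardSuperconductivity.Theorems.KLProgrammeKLRegimeTwoLegCurvatureConsts
import Summits.HubbardSuperconductivity.HubbardSuperconductivity.Theorems.KLProgrammeKLRegimeEngineTwoLegStepV17F2Doors

/-!
# K3 gen-7F engine-flow child (rev-2 bundle `klPredsV17F2`; stmt-HubbardSuperconductivity-20368 and its re-keyed successor), stub (M)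
# `stub_twoLeg_scale0`: the CLOSER SHAPE — `TwoLegStepV17F2 … 0` from stub 6-F's scale-0 reading jets, ONE covariance number `a₁`, four numerals, and the two nested legs

Cell gate-hubbard-kl, seat p1b (g8), (M) owner.  One application of r2d-p1's `twoLegStepV17F2_of_jets_slopes_nestedLegs` (…TwoLegStepV17F2Doors) to
(A) `twoLegReadJetsF_of_readJetBound_le` (stub 6-F's `TwoLegReadJetBound … (klFlowFrameU … 0) 0` at tables below the package), (B) p1b's
`twoLegSlopes_bareFrame` (…EngineTwoLegSlopesBareFrame: the bare-frame field strength and normal slope from `a₁ ≥ A₁(R,U)`, p3's definite weighted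
decay constant), (C) the two nested-leg rates:
* **`twoLegStepV17F2_zero_of_readJetBound_bareSlopes`** — generic package `(G, Q)` and jet tables `(cJ, cJ')` with `cJ ≤ G.S`, `cJ' ≤ Q.S'`, curve thresholds;
* **`twoLegStepV17F2_zero_klC4a`** — the instance at the REGISTERED tables `klC4aJetC` / `klC4aJetC' P R` and package `klEngGeo6` / `klEngQ6 P R`
  ([tree] `klC4aJetC_le_klEngGeo6_S`, `klC4aJetC'_le_klEngQ6_S'`), i.e. the engine-flow template's (M) modulo: the regime conversion
  (`klEngC₃6 ≤ klCurveC3`, `klEngU₀6 ≤ klCurveU0 ∧ ≤ 1` — one `le_trans` each), the choice of `a₁` with `A₁(R,U) ≤ a₁`, the four numerals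
  (`16e⁹κ₀²·klScaleZeroA0·|U| ≤ 1/4`, `16e⁹κ₀²·a₁·|U| ≤ 1/2`, `2^{10}e¹⁸κ₀⁴a₁U² ≤ cz|U|`, `2^{11}e¹⁸κ₀⁴a₁U² + (4/3)Gfr₁U² ≤ cz|U|·cDtmin/2`), and (C).
Proofs only; no definitions.  References: BGM 2006 §3 (3.2)–(3.3) [cite: BenfattoGiulianiMastropietro2006].
-/

noncomputable section

namespace Summit.HubbardSuperconductivity.HubbardSuperconductivity.Theorems.EngineV8

set_option linter.dupNamespace false -- summit = problem name (single-conjunct summit), D-0017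

open Real Finset Literature.MathematicalPhysics.QuantumLattice Literature.Probability.LatticeModels
open Literature.MathematicalPhysics.QuantumLattice.FermiRG Literature.MathematicalPhysics.QuantumLattice.BandSectorCounting
open Summit.HubbardSuperconductivity.HubbardSuperconductivity.Theorems.KLProgrammeLegKernels
open Summit.HubbardSuperconductivity.HubbardSuperconductivity.Theorems.DispersionFlow
open Summit.HubbardSuperconductivity.HubbardSuperconductivity.Theorems.PerturbedFermiCurve
open Summit.HubbardSuperconductivity.HubbardSuperconductivity.Theorems.KLRegimeSplit

section ZeroCloser

variable {L M : ℕ} [NeZero L] [NeZero M] {P : SplitConsts} {R : RenConsts} {μ U β c a₁ : ℝ}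

/-- **(M) CLOSER SHAPE, generic package (rev-2 slot)**: `TwoLegStepV17F2 L M G P Q R β U μ 0` from stub 6-F's scale-`0` reading jets at tables `(cJ, cJ')` below
`(G.S, Q.S')`, the bare-frame slopes data (`a₁ ≥ A₁(R,U)` + four numerals), and the two nested-leg rates of the scale-`0` local part. -/
theorem twoLegStepV17F2_zero_of_readJetBound_bareSlopes (G : GeoConsts) (Q : EngConsts) (hRW : R.WF) (hc : 0 < c) (hcle : c ≤ klCurveC3 R)
    (hμ : μ ∈ klWindowC) (hU : 0 < U) (hUle : U ≤ klCurveU0 R) (hU1 : U ≤ 1) (hβ : klBetaMin ≤ β) (hβc : β ≤ Real.exp (c / U ^ 2))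
    (hL : klEngL₃ β U ≤ L) (hM : klEngM₃ β U L ≤ M) (hCL : 0 ≤ Q.CL β 0)
    -- (A) stub 6-F at scale 0 and the package inequalities of its tables
    {cJ cJ' : ℕ → ℝ} (hpk : ∀ k, cJ k ≤ G.S k) (hpk' : ∀ k, cJ' k ≤ Q.S' k)
    (hJ : TwoLegReadJetBound L M cJ cJ' β U μ (klFlowFrameU L M β U μ 0) 0)
    -- (B) the bare-frame slopes data
    (ha : 0 < a₁)
    (hA : klScaleZeroA0 + uvTimeMomentConst klE0 7 32 +
          2 * (uvSpaceMomentConst klE0 1 (uvPieceSq klE0 (uvBaseQ klCutoffX5 klE0 4) (uvBaseQ' klCutoffX5 klE0 4)) +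
            (1 / 4 * Real.sqrt (216 * (1 / klE0 + 1 / 2)) *
                ∑ e : Fin 2 × Fin 2, (uvLinV klE0 (1 + (e.1 : ℕ) + (e.2 : ℕ)) *
                    (klCutoffX5 * ((1 + ((e.1 : ℕ) + (e.2 : ℕ)) + 2).factorial : ℝ) * (4 / klE0) ^ (1 + ((e.1 : ℕ) + (e.2 : ℕ)) + 1)) +
                  uvLinD klE0 (1 + (e.1 : ℕ) + (e.2 : ℕ)) *
                    (klCutoffX5 * ((1 + ((e.1 : ℕ) + (e.2 : ℕ)) + 3).factorial : ℝ) * (4 / klE0) ^ (1 + ((e.1 : ℕ) + (e.2 : ℕ)) + 2)))) *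
              (4608 * (1 + R.Gfr 0 + R.Gfr 1 + R.Gfr 2 + R.Gfr 3) ^ 4 * ((((0 : ℕ) : ℝ) + 1) * U ^ 2 + 2 * |U|))) ≤ a₁)
    (hsmall₀ : 16 * Real.exp 1 ^ 9 * Real.sqrt (2 * (7 + 1606732)) ^ 2 * klScaleZeroA0 * |U| ≤ 1 / 4)
    (hsmall₁ : 16 * Real.exp 1 ^ 9 * Real.sqrt (2 * (7 + 1606732)) ^ 2 * a₁ * |U| ≤ 1 / 2)
    (hfitz : (2 : ℝ) ^ 10 * Real.exp 1 ^ 18 * Real.sqrt (2 * (7 + 1606732)) ^ 4 * a₁ * U ^ 2 ≤ R.cz * |U|)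
    (hfit1 : (2 : ℝ) ^ 11 * Real.exp 1 ^ 18 * Real.sqrt (2 * (7 + 1606732)) ^ 4 * a₁ * U ^ 2 + 4 / 3 * R.Gfr 1 * U ^ 2 ≤
      R.cz * |U| * (cDtmin (-1.2) (-0.05) / 2))
    -- (C) the two nested-leg rates of the scale-0 local part (empty histories)
    (hcut : ∀ (Mq : ℕ → ℕ) (L₁ M₁ M₂ : ℕ) [NeZero L₁] [NeZero M₁] [NeZero M₂], L ≤ L₁ → Q.M0 β L₁ ≤ M₁ → Mq L₁ ≤ M₁ → M₁ ≤ M₂ →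
      (∀ j < 0, histV17F2 L₁ M₁ G P Q R β U μ j ∧ TwoLegSlopes L₁ M₁ R β U μ (klFlowFrameU L₁ M₁ β U μ j) j) →
      (∀ j < 0, histV17F2 L₁ M₂ G P Q R β U μ j ∧ TwoLegSlopes L₁ M₂ R β U μ (klFlowFrameU L₁ M₂ β U μ j) j) →
        ∀ θ : ℝ, |klLocalPart L₁ M₁ β U μ (klFlowFrameU L₁ M₁ β U μ 0) 0 θ -
          klLocalPart L₁ M₂ β U μ (klFlowFrameU L₁ M₂ β U μ 0) 0 θ| ≤ Q.CL β 0 / 4 / L₁)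
    (hsp : ∀ (Mq : ℕ → ℕ) (L₁ L₂ M₂ : ℕ) [NeZero L₁] [NeZero L₂] [NeZero M₂], L ≤ L₁ → L₁ ∣ L₂ → Q.M0 β L₁ ≤ M₂ → Mq L₁ ≤ M₂ →
      Q.M0 β L₂ ≤ M₂ → Mq L₂ ≤ M₂ →
      (∀ j < 0, histV17F2 L₁ M₂ G P Q R β U μ j ∧ TwoLegSlopes L₁ M₂ R β U μ (klFlowFrameU L₁ M₂ β U μ j) j) →
      (∀ j < 0, histV17F2 L₂ M₂ G P Q R β U μ j ∧ TwoLegSlopes L₂ M₂ R β U μ (klFlowFrameU L₂ M₂ β U μ j) j) →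
        ∀ θ : ℝ, |klLocalPart L₁ M₂ β U μ (klFlowFrameU L₁ M₂ β U μ 0) 0 θ -
          klLocalPart L₂ M₂ β U μ (klFlowFrameU L₂ M₂ β U μ 0) 0 θ| ≤ Q.CL β 0 / 4 / L₁) :
    TwoLegStepV17F2 L M G P Q R β U μ 0 :=
  twoLegStepV17F2_of_jets_slopes_nestedLegs (twoLegReadJetsF_of_readJetBound_le hpk hpk' hJ)
    (twoLegSlopes_bareFrame (L := L) (M := M) hRW hc hcle hμ hU hUle hU1 hβ hβc hL hM ha hA hsmall₀ hsmall₁ hfitz hfit1) hCL hcut hsp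

/-- **(M) CLOSER SHAPE AT THE REGISTERED TABLES AND PACKAGE** (`klC4aJetC` / `klC4aJetC' P R`, `klEngGeo6` / `klEngQ6 P R`): the engine-flow
template's `stub_twoLeg_scale0` modulo the regime conversion to curve thresholds, `a₁` with `A₁(R,U) ≤ a₁`, the four numerals, and the nested legs. -/
theorem twoLegStepV17F2_zero_klC4a (hRW : R.WF) (hc : 0 < c) (hcle : c ≤ klCurveC3 R) (hμ : μ ∈ klWindowC) (hU : 0 < U)
    (hUle : U ≤ klCurveU0 R) (hU1 : U ≤ 1) (hβ : klBetaMin ≤ β) (hβc : β ≤ Real.exp (c / U ^ 2)) (hL : klEngL₃ β U ≤ L)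
    (hM : klEngM₃ β U L ≤ M) (hCL : 0 ≤ (klEngQ6 P R).CL β 0)
    (hJ : TwoLegReadJetBound L M klC4aJetC (klC4aJetC' P R) β U μ (klFlowFrameU L M β U μ 0) 0)
    (ha : 0 < a₁)
    (hA : klScaleZeroA0 + uvTimeMomentConst klE0 7 32 +
          2 * (uvSpaceMomentConst klE0 1 (uvPieceSq klE0 (uvBaseQ klCutoffX5 klE0 4) (uvBaseQ' klCutoffX5 klE0 4)) +
            (1 / 4 * Real.sqrt (216 * (1 / klE0 + 1 / 2)) *
                ∑ e : Fin 2 × Fin 2, (uvLinV klE0 (1 + (e.1 : ℕ) + (e.2 : ℕ)) *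
                    (klCutoffX5 * ((1 + ((e.1 : ℕ) + (e.2 : ℕ)) + 2).factorial : ℝ) * (4 / klE0) ^ (1 + ((e.1 : ℕ) + (e.2 : ℕ)) + 1)) +
                  uvLinD klE0 (1 + (e.1 : ℕ) + (e.2 : ℕ)) *
                    (klCutoffX5 * ((1 + ((e.1 : ℕ) + (e.2 : ℕ)) + 3).factorial : ℝ) * (4 / klE0) ^ (1 + ((e.1 : ℕ) + (e.2 : ℕ)) + 2)))) *
              (4608 * (1 + R.Gfr 0 + R.Gfr 1 + R.Gfr 2 + R.Gfr 3) ^ 4 * ((((0 : ℕ) : ℝ) + 1) * U ^ 2 + 2 * |U|))) ≤ a₁)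
    (hsmall₀ : 16 * Real.exp 1 ^ 9 * Real.sqrt (2 * (7 + 1606732)) ^ 2 * klScaleZeroA0 * |U| ≤ 1 / 4)
    (hsmall₁ : 16 * Real.exp 1 ^ 9 * Real.sqrt (2 * (7 + 1606732)) ^ 2 * a₁ * |U| ≤ 1 / 2)
    (hfitz : (2 : ℝ) ^ 10 * Real.exp 1 ^ 18 * Real.sqrt (2 * (7 + 1606732)) ^ 4 * a₁ * U ^ 2 ≤ R.cz * |U|)
    (hfit1 : (2 : ℝ) ^ 11 * Real.exp 1 ^ 18 * Real.sqrt (2 * (7 + 1606732)) ^ 4 * a₁ * U ^ 2 + 4 / 3 * R.Gfr 1 * U ^ 2 ≤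
      R.cz * |U| * (cDtmin (-1.2) (-0.05) / 2))
    (hcut : ∀ (Mq : ℕ → ℕ) (L₁ M₁ M₂ : ℕ) [NeZero L₁] [NeZero M₁] [NeZero M₂], L ≤ L₁ → (klEngQ6 P R).M0 β L₁ ≤ M₁ → Mq L₁ ≤ M₁ →
      M₁ ≤ M₂ →
      (∀ j < 0, histV17F2 L₁ M₁ klEngGeo6 P (klEngQ6 P R) R β U μ j ∧ TwoLegSlopes L₁ M₁ R β U μ (klFlowFrameU L₁ M₁ β U μ j) j) →
      (∀ j < 0, histV17F2 L₁ M₂ klEngGeo6 P (klEngQ6 P R) R β U μ j ∧ TwoLegSlopes L₁ M₂ R β U μ (klFlowFrameU L₁ M₂ β U μ j) j) →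
        ∀ θ : ℝ, |klLocalPart L₁ M₁ β U μ (klFlowFrameU L₁ M₁ β U μ 0) 0 θ -
          klLocalPart L₁ M₂ β U μ (klFlowFrameU L₁ M₂ β U μ 0) 0 θ| ≤ (klEngQ6 P R).CL β 0 / 4 / L₁)
    (hsp : ∀ (Mq : ℕ → ℕ) (L₁ L₂ M₂ : ℕ) [NeZero L₁] [NeZero L₂] [NeZero M₂], L ≤ L₁ → L₁ ∣ L₂ → (klEngQ6 P R).M0 β L₁ ≤ M₂ →
      Mq L₁ ≤ M₂ → (klEngQ6 P R).M0 β L₂ ≤ M₂ → Mq L₂ ≤ M₂ →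
      (∀ j < 0, histV17F2 L₁ M₂ klEngGeo6 P (klEngQ6 P R) R β U μ j ∧ TwoLegSlopes L₁ M₂ R β U μ (klFlowFrameU L₁ M₂ β U μ j) j) →
      (∀ j < 0, histV17F2 L₂ M₂ klEngGeo6 P (klEngQ6 P R) R β U μ j ∧ TwoLegSlopes L₂ M₂ R β U μ (klFlowFrameU L₂ M₂ β U μ j) j) →
        ∀ θ : ℝ, |klLocalPart L₁ M₂ β U μ (klFlowFrameU L₁ M₂ β U μ 0) 0 θ -
          klLocalPart L₂ M₂ β U μ (klFlowFrameU L₂ M₂ β U μ 0) 0 θ| ≤ (klEngQ6 P R).CL β 0 / 4 / L₁) :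
    TwoLegStepV17F2 L M klEngGeo6 P (klEngQ6 P R) R β U μ 0 :=
  twoLegStepV17F2_zero_of_readJetBound_bareSlopes klEngGeo6 (klEngQ6 P R) hRW hc hcle hμ hU hUle hU1 hβ hβc hL hM hCL
    klC4aJetC_le_klEngGeo6_S (klC4aJetC'_le_klEngQ6_S' P R) hJ ha hA hsmall₀ hsmall₁ hfitz hfit1 hcut hsp

end ZeroCloser

end Summit.HubbardSuperconductivity.HubbardSuperconductivity.Theorems.EngineV8

end
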